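import Mathlib
import Summits.MatrixMultiplication.MatrixMultiplication.Theses.NilpotentLieHosts
import Summits.MatrixMultiplication.MatrixMultiplication.Theorems.NilpotentLieHostsNilpotentThresholdDesignsStubRecenter
import Summits.MatrixMultiplication.MatrixMultiplication.Theorems.NilpotentLieHostsNilpotentThresholdDesignsStubIndicator

/-!
# Crux `NilpotentThresholdDesigns` (stmt-MatrixMultiplication-7720) — `Lines/birth.lean`, the BC3 birth skeleton

Route `NilpotentLieHosts` (sub-problem `MatrixMultiplication`), crux #0 `NilpotentThresholdDesigns` (the DESIGN half
of the thesis; auto-crux: an underived hypothesis of the deciding theorem `closes`).  The crux asks, for ONE `d ≥ 3`,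
every loss `δ > 0` and unboundedly many degree budgets `s`, for finite `X, Y, Z ⊂ U_d(ℤ)` (upper unitriangular
elements of `SL(d,ℤ)`) with the TPP in embedding form, BCGPU separating polynomials of `(j−i)`-weighted degree
`≤ s` for every target `x₀ z₀⁻¹` (arXiv:2410.14905 Def 2.1 on `X Y⁻¹ Y Z⁻¹`), and `|X||Y||Z| ≥ s^((3/4)d(d−1) − δ)`.

## The line: RECENTRED IDENTITY CERTIFICATES (the discrete, exact `U_d(ℤ)` form of BCGPU24 §2.4)

BlasiakCohnGrochowPrattUmans2024 §2.4 / Lemma 2.11 ("splitting separating functions into invariant functions and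
the double-product property") reduces the design of the `|X||Z|` separating polynomials `f_{x,z}` to ONE polynomial
`p₀` in an invariant ring plus interpolation ("instead of a whole set `{f_{x,z}}` … at most three polynomials",
p. 18), and Thm 2.10 builds separators as PRODUCTS OF LAGRANGE INDICATORS composed with few polynomial coordinates
(`r(M[1,1]) s(M) t(M)`, p. 17), recentring the later rounds at the target (`x₀ M z₀`).  In the unipotent host both
devices are exact (no border rank, no `ε`), and they cut the crux into three named pieces:

* `stub_recenter`  (M, provable now) — TWO-SIDED TRANSLATION STABILITY OF WEIGHTED DEGREE: for `g, h ∈ U_d(ℤ)` and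
  any `p`, some `p'` of no larger `(j−i)`-weighted degree has `p'(M) = p(g⁻¹ M h)` for every `M ∈ SL(d,ℤ)`
  (the substitution `X_kl ↦ Σ_{k ≤ i, j ≤ l} (g⁻¹)_ki h_jl X_ij` is weight-non-increasing because `g⁻¹, h` are upper
  triangular).  This is the statement that `Pol^wt_≤s` is a `U_d × U_d`-bimodule — the translation-closure that
  makes it a `RepFun` space (Thm 2.2 / Rem 2.4, the route's cost side) — used here on the design side to move
  every target `x₀ z₀⁻¹` to the identity.
* `stub_indicator` (M, provable now) — LAGRANGE THROUGH COORDINATES: polynomial coordinates `u₁ … u_k` whose values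
  on the configuration lie in finite sets `V_i ∋ t_i` give ONE polynomial `L` with `L = [u = t]` there and
  `wdeg L ≤ Σ_i wdeg(u_i)·(|V_i| − 1)` (`L = Π_i Π_{v ∈ V_i, v ≠ t_i} (u_i − v)/(t_i − v)`; weighted degree is
  sub-additive under products).  The multivariate, weighted, through-coordinates Lagrange basis is not in Mathlib
  (`Lagrange.basis` is univariate).
* `stub_designs`   (XL, OPEN — the load-bearing bet; transfer target C⁺) — IDENTITY CERTIFICATES AT HALF DIMENSION:
  for some `d ≥ 3`, every `δ > 0` and unboundedly many `s`: `X, Y, Z ⊂ U_d(ℤ)` of size `|X||Y||Z| ≥ s^((3/2)D − δ)`,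
  `D = d(d−1)/2`, together with ONE coordinate system `u : Fin k → Pol` and value sets `V_i` of total price
  `Σ_i wdeg(u_i)(|V_i| − 1) ≤ s` such that on the recentred sextuple set `S = X⁻¹X · Y⁻¹Y · Z⁻¹Z` the coordinates
  take values in `V` and CUT OUT THE IDENTITY: `u(x₀⁻¹ x y⁻¹ y' z⁻¹ z₀) = u(1) ↔ (x = x₀ ∧ y = y' ∧ z = z₀)`.
  Why easier than the crux as filed: it asks for ONE chart `(u, V)` instead of `|X||Z|` polynomials, its only
  global constraint is the PRICE `Σ wdeg·(#values − 1) ≤ s` (a chart may consist of XZ-invariants with few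
  values on `S` plus a few weight-one entries: at `d = 3`, `X = exp(ℤe₁₂)`, `Y = exp(2ℤ(e₁₂+e₂₃))`, `Z = exp(ℤe₂₃)`
  cut to boxes of side `q`, the invariant `e₁₃ − e₁₂e₂₃` (`= −Δ²/2` on `S`, CU03 Cor 14 / the route header) and the
  entries `e₁₂, e₂₃` form a chart of price `O(q)` — exponent `3` of the needed `9/2`), and the TPP is not a
  separate requirement (it follows, below).
  It is NOT equivalent to the crux by rewording: the crux's separators may depend arbitrarily on the target, a
  certificate may not (one chart, recentred), and conversely a certificate is not yet a polynomial of degree `≤ s`.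

`NilpotentThresholdDesigns_of : Sig.stub_recenter → Sig.stub_indicator → Sig.stub_designs → NilpotentThresholdDesigns`
is a REAL proof (no `sorry` of its own): the TPP in embedding form is DERIVED from the identity certificate
(`x y⁻¹ y' z⁻¹ = x' z'⁻¹` makes the recentred point `x'⁻¹ x y⁻¹ y' z⁻¹ z'` the identity, whose coordinates are `u(1)`),
and the separator for the target `(x₀, z₀)` is the Lagrange indicator of `u = u(1)` (`stub_indicator`, values
certified on `S`) pulled back along `M ↦ x₀⁻¹ M z₀` (`stub_recenter`), of weighted degree `≤ price ≤ s`; the empty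
middle set is the degenerate case `p = 0`.  `NilpotentThresholdDesigns_skeleton : NilpotentThresholdDesigns` feeds the
three registered stubs to it (the crux BY NAME; `closed = false` only through `stub_*`).

Disproof used: none exists — `ledger crux ls stmt-MatrixMultiplication-7720` shows no `Disproof.lean`, no
`Theorems/NilpotentThresholdDesigns/Negative/*` lemma has landed, `ledger negatives --problem MatrixMultiplication`
lists no statement about unitriangular designs; the route's own negative crux `HeisenbergThresholdObstruction`
(d = 3 power saving) would, if proved, kill only the `d = 3` instances of `stub_designs` (the stub keeps `∃ d ≥ 3`).
-/

set_option linter.dupNamespace false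

namespace Summit.MatrixMultiplication.MatrixMultiplication.Cruxes.NilpotentThresholdDesigns.Birth

open Summit.MatrixMultiplication.MatrixMultiplication.Theses.NilpotentLieHosts
open scoped BigOperators Matrix Classical

/-! ## Stub signatures (named, so that the composition takes them BY NAME) -/

/-- Signature of STUB 1 (`stub_recenter`): two-sided translation by unitriangular `g⁻¹ · _ · h` does not increase the
`(j−i)`-weighted degree — for every `p` there is `p'` with `wdeg p' ≤ wdeg p` and `p'(M) = p(g⁻¹ M h)` on `SL(d,ℤ)`. -/
abbrev Sig.stub_recenter : Prop :=
  ∀ (d : ℕ) (g h : Matrix.SpecialLinearGroup (Fin d) ℤ),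
    (∀ i j : Fin d, j ≤ i → (g : Matrix (Fin d) (Fin d) ℤ) i j = if i = j then 1 else 0) →
    (∀ i j : Fin d, j ≤ i → (h : Matrix (Fin d) (Fin d) ℤ) i j = if i = j then 1 else 0) →
    ∀ p : MvPolynomial (Fin d × Fin d) ℂ, ∃ p' : MvPolynomial (Fin d × Fin d) ℂ,
      MvPolynomial.weightedTotalDegree (fun ij : Fin d × Fin d => (ij.2 : ℕ) - ij.1) p' ≤
          MvPolynomial.weightedTotalDegree (fun ij : Fin d × Fin d => (ij.2 : ℕ) - ij.1) p ∧
      ∀ M : Matrix.SpecialLinearGroup (Fin d) ℤ,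
        MvPolynomial.eval (fun ij : Fin d × Fin d => ((M : Matrix (Fin d) (Fin d) ℤ) ij.1 ij.2 : ℂ)) p' =
          MvPolynomial.eval (fun ij : Fin d × Fin d =>
            (((g⁻¹ * M * h : Matrix.SpecialLinearGroup (Fin d) ℤ) : Matrix (Fin d) (Fin d) ℤ) ij.1 ij.2 : ℂ)) p

/-- Signature of STUB 2 (`stub_indicator`): Lagrange interpolation through polynomial coordinates — the indicator of
`u = t` on the points whose coordinates lie in the finite value sets `V`, of weighted degree `≤ Σ wdeg(u_i)(|V_i|−1)`. -/
abbrev Sig.stub_indicator : Prop :=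
  ∀ (d k : ℕ) (u : Fin k → MvPolynomial (Fin d × Fin d) ℂ) (V : Fin k → Finset ℂ) (t : Fin k → ℂ),
    (∀ i, t i ∈ V i) →
    ∃ L : MvPolynomial (Fin d × Fin d) ℂ,
      MvPolynomial.weightedTotalDegree (fun ij : Fin d × Fin d => (ij.2 : ℕ) - ij.1) L ≤
          ∑ i : Fin k, MvPolynomial.weightedTotalDegree (fun ij : Fin d × Fin d => (ij.2 : ℕ) - ij.1) (u i) *
            ((V i).card - 1) ∧
      ∀ M : Fin d × Fin d → ℂ, (∀ i, MvPolynomial.eval M (u i) ∈ V i) →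
        MvPolynomial.eval M L = if (∀ i, MvPolynomial.eval M (u i) = t i) then 1 else 0

/-- Signature of STUB 3 (`stub_designs`, OPEN): recentred identity certificates at half dimension in some `U_d(ℤ)`,
`d ≥ 3` — one coordinate chart `(u, V)` of price `Σ wdeg(u_i)(|V_i| − 1) ≤ s` whose values on
`X⁻¹X Y⁻¹Y Z⁻¹Z` lie in `V` and equal `u(1)` exactly at the trivial solutions, with `|X||Y||Z| ≥ s^((3/4)d(d−1) − δ)`. -/
abbrev Sig.stub_designs : Prop :=
  ∃ d : ℕ, 3 ≤ d ∧ ∀ δ : ℝ, 0 < δ → ∀ s₀ : ℕ, ∃ s : ℕ, s₀ ≤ s ∧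
    ∃ X Y Z : Finset (Matrix.SpecialLinearGroup (Fin d) ℤ),
      (∀ g ∈ X ∪ Y ∪ Z, ∀ i j : Fin d, j ≤ i → (g : Matrix (Fin d) (Fin d) ℤ) i j = if i = j then 1 else 0) ∧
      (∃ (k : ℕ) (u : Fin k → MvPolynomial (Fin d × Fin d) ℂ) (V : Fin k → Finset ℂ),
        (∑ i : Fin k, MvPolynomial.weightedTotalDegree (fun ij : Fin d × Fin d => (ij.2 : ℕ) - ij.1) (u i) *
            ((V i).card - 1) ≤ s) ∧
        ∀ x₀ ∈ X, ∀ x ∈ X, ∀ y ∈ Y, ∀ y' ∈ Y, ∀ z ∈ Z, ∀ z₀ ∈ Z,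
          (∀ i, MvPolynomial.eval (fun ij : Fin d × Fin d =>
              (((x₀⁻¹ * x * y⁻¹ * y' * z⁻¹ * z₀ : Matrix.SpecialLinearGroup (Fin d) ℤ) :
                Matrix (Fin d) (Fin d) ℤ) ij.1 ij.2 : ℂ)) (u i) ∈ V i) ∧
          ((∀ i, MvPolynomial.eval (fun ij : Fin d × Fin d =>
              (((x₀⁻¹ * x * y⁻¹ * y' * z⁻¹ * z₀ : Matrix.SpecialLinearGroup (Fin d) ℤ) :
                Matrix (Fin d) (Fin d) ℤ) ij.1 ij.2 : ℂ)) (u i) =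
            MvPolynomial.eval (fun ij : Fin d × Fin d =>
              (((1 : Matrix.SpecialLinearGroup (Fin d) ℤ) : Matrix (Fin d) (Fin d) ℤ) ij.1 ij.2 : ℂ)) (u i)) ↔
            (x = x₀ ∧ y = y' ∧ z = z₀))) ∧
      (s : ℝ) ^ ((3 : ℝ) / 4 * d * (d - 1) - δ) ≤ (X.card : ℝ) * Y.card * Z.card

/-! ## Registered stubs (the only `sorry`s of the file; signatures spelled out for the registry) -/

/-- STUB 1 — two-sided translation stability of the `(j−i)`-weighted degree (`Pol^wt` is a `U_d × U_d`-bimodule):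
for unitriangular `g, h ∈ SL(d,ℤ)` and any `p` there is `p'` with `wdeg p' ≤ wdeg p` and `p'(M) = p(g⁻¹ M h)` for all
`M ∈ SL(d,ℤ)`.  LANDED as `Theorems.NilpotentThresholdDesigns.stub_recenter` (p146796): `p' := bind₁ (X_kl ↦ Σ (g⁻¹)_ki h_jl X_ij)`, the inverse of a unitriangular matrix
is unitriangular (adjugate), and each substituted monomial has weight `j − i ≤ l − k`. [BlasiakCohnGrochowPrattUmans2024, Thm 2.2 / Rem 2.4] -/
theorem stub_recenter :
    ∀ (d : ℕ) (g h : Matrix.SpecialLinearGroup (Fin d) ℤ),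
    (∀ i j : Fin d, j ≤ i → (g : Matrix (Fin d) (Fin d) ℤ) i j = if i = j then 1 else 0) →
    (∀ i j : Fin d, j ≤ i → (h : Matrix (Fin d) (Fin d) ℤ) i j = if i = j then 1 else 0) →
    ∀ p : MvPolynomial (Fin d × Fin d) ℂ, ∃ p' : MvPolynomial (Fin d × Fin d) ℂ,
      MvPolynomial.weightedTotalDegree (fun ij : Fin d × Fin d => (ij.2 : ℕ) - ij.1) p' ≤
          MvPolynomial.weightedTotalDegree (fun ij : Fin d × Fin d => (ij.2 : ℕ) - ij.1) p ∧
      ∀ M : Matrix.SpecialLinearGroup (Fin d) ℤ,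
        MvPolynomial.eval (fun ij : Fin d × Fin d => ((M : Matrix (Fin d) (Fin d) ℤ) ij.1 ij.2 : ℂ)) p' =
          MvPolynomial.eval (fun ij : Fin d × Fin d =>
            (((g⁻¹ * M * h : Matrix.SpecialLinearGroup (Fin d) ℤ) : Matrix (Fin d) (Fin d) ℤ) ij.1 ij.2 : ℂ)) p :=
  -- LANDED (p146796): Theorems/NilpotentLieHostsNilpotentThresholdDesignsStubRecenter.lean
  _root_.Summit.MatrixMultiplication.MatrixMultiplication.Theorems.NilpotentThresholdDesigns.stub_recenter

/-- STUB 2 — Lagrange through coordinates: given polynomial coordinates `u_i`, finite value sets `V_i` and target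
values `t_i ∈ V_i`, there is ONE polynomial `L` with `wdeg L ≤ Σ_i wdeg(u_i)·(|V_i| − 1)` and
`L(M) = [∀ i, u_i(M) = t_i]` at every point `M` whose coordinates lie in `V`.  LANDED as `Theorems.NilpotentThresholdDesigns.stub_indicator` (p147138):
`L = Π_i Π_{v ∈ V_i ∖ {t_i}} (t_i − v)⁻¹ • (u_i − C v)`, weighted degree sub-additive under products.
[BlasiakCohnGrochowPrattUmans2024, Thm 2.10] -/
theorem stub_indicator :
    ∀ (d k : ℕ) (u : Fin k → MvPolynomial (Fin d × Fin d) ℂ) (V : Fin k → Finset ℂ) (t : Fin k → ℂ),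
    (∀ i, t i ∈ V i) →
    ∃ L : MvPolynomial (Fin d × Fin d) ℂ,
      MvPolynomial.weightedTotalDegree (fun ij : Fin d × Fin d => (ij.2 : ℕ) - ij.1) L ≤
          ∑ i : Fin k, MvPolynomial.weightedTotalDegree (fun ij : Fin d × Fin d => (ij.2 : ℕ) - ij.1) (u i) *
            ((V i).card - 1) ∧
      ∀ M : Fin d × Fin d → ℂ, (∀ i, MvPolynomial.eval M (u i) ∈ V i) →
        MvPolynomial.eval M L = if (∀ i, MvPolynomial.eval M (u i) = t i) then 1 else 0 :=
  -- LANDED (p147138): Theorems/NilpotentLieHostsNilpotentThresholdDesignsStubIndicator.lean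
  _root_.Summit.MatrixMultiplication.MatrixMultiplication.Theorems.NilpotentThresholdDesigns.stub_indicator

/-- STUB 3 — THE OPEN, LOAD-BEARING STUB (transfer target C⁺ of the crux): recentred identity certificates at half
dimension.  For some `d ≥ 3`, every `δ > 0` and every `s₀` there are `s ≥ s₀`, finite `X, Y, Z ⊂ U_d(ℤ)` and ONE
coordinate chart `u : Fin k → Pol`, `V : Fin k → Finset ℂ` of price `Σ_i wdeg(u_i)·(|V_i| − 1) ≤ s` such that on every
recentred point `q = x₀⁻¹ x y⁻¹ y' z⁻¹ z₀` (`x₀, x ∈ X`, `y, y' ∈ Y`, `z, z₀ ∈ Z`) the coordinates lie in `V` and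
`u(q) = u(1) ↔ (x = x₀ ∧ y = y' ∧ z = z₀)`, and `|X||Y||Z| ≥ s^((3/4)d(d−1) − δ)`.  Size XL / open: at `d = 3` it is the
Heisenberg design problem (known exponent 3, CU03 Cor 14, against the needed 9/2); for `d ≥ 4` the chart may use
several invariants (BCGPU24 §2.4: the double-coset space `X\G/Z` is no longer one-dimensional).
[CohnUmans2003, Prop 13 / Cor 14; BlasiakCohnGrochowPrattUmans2024, §2.4, §4] -/
theorem stub_designs :
    ∃ d : ℕ, 3 ≤ d ∧ ∀ δ : ℝ, 0 < δ → ∀ s₀ : ℕ, ∃ s : ℕ, s₀ ≤ s ∧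
    ∃ X Y Z : Finset (Matrix.SpecialLinearGroup (Fin d) ℤ),
      (∀ g ∈ X ∪ Y ∪ Z, ∀ i j : Fin d, j ≤ i → (g : Matrix (Fin d) (Fin d) ℤ) i j = if i = j then 1 else 0) ∧
      (∃ (k : ℕ) (u : Fin k → MvPolynomial (Fin d × Fin d) ℂ) (V : Fin k → Finset ℂ),
        (∑ i : Fin k, MvPolynomial.weightedTotalDegree (fun ij : Fin d × Fin d => (ij.2 : ℕ) - ij.1) (u i) *
            ((V i).card - 1) ≤ s) ∧
        ∀ x₀ ∈ X, ∀ x ∈ X, ∀ y ∈ Y, ∀ y' ∈ Y, ∀ z ∈ Z, ∀ z₀ ∈ Z,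
          (∀ i, MvPolynomial.eval (fun ij : Fin d × Fin d =>
              (((x₀⁻¹ * x * y⁻¹ * y' * z⁻¹ * z₀ : Matrix.SpecialLinearGroup (Fin d) ℤ) :
                Matrix (Fin d) (Fin d) ℤ) ij.1 ij.2 : ℂ)) (u i) ∈ V i) ∧
          ((∀ i, MvPolynomial.eval (fun ij : Fin d × Fin d =>
              (((x₀⁻¹ * x * y⁻¹ * y' * z⁻¹ * z₀ : Matrix.SpecialLinearGroup (Fin d) ℤ) :
                Matrix (Fin d) (Fin d) ℤ) ij.1 ij.2 : ℂ)) (u i) =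
            MvPolynomial.eval (fun ij : Fin d × Fin d =>
              (((1 : Matrix.SpecialLinearGroup (Fin d) ℤ) : Matrix (Fin d) (Fin d) ℤ) ij.1 ij.2 : ℂ)) (u i)) ↔
            (x = x₀ ∧ y = y' ∧ z = z₀))) ∧
      (s : ℝ) ^ ((3 : ℝ) / 4 * d * (d - 1) - δ) ≤ (X.card : ℝ) * Y.card * Z.card := by
  sorry

/-! ## Composition (real proof; no `sorry` of its own) -/

/-- **COMPOSITION.** The three stub statements prove the crux `NilpotentThresholdDesigns` BY NAME: the TPP in
embedding form is read off the identity certificate (a solution `x y⁻¹ y' z⁻¹ = x' z'⁻¹` recentres to the identity),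
and the separating polynomial for the target `(x₀, z₀)` is the Lagrange indicator of `u = u(1)` (`stub_indicator`)
pulled back along `M ↦ x₀⁻¹ M z₀` (`stub_recenter`), of weighted degree at most the price `≤ s`; an empty middle set
`Y` is the degenerate case `p = 0`.  Sizes are carried over verbatim. [BlasiakCohnGrochowPrattUmans2024, §2.4] -/
theorem NilpotentThresholdDesigns_of :
    Sig.stub_recenter → Sig.stub_indicator → Sig.stub_designs → NilpotentThresholdDesigns := by
  rintro hRec hInd ⟨d, hd, hD⟩
  refine ⟨d, hd, fun δ hδ s₀ => ?_⟩
  obtain ⟨s, hs, X, Y, Z, hU, ⟨k, u, V, hprice, hcert⟩, hsize⟩ := hD δ hδ s₀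
  refine ⟨s, hs, X, Y, Z, hU, ?_, ?_, hsize⟩
  · -- the TPP in embedding form, from the identity certificate
    intro x hx x' hx' y hy y' hy' z hz z' hz' hprod
    obtain ⟨-, hiff⟩ := hcert x' hx' x hx y hy y' hy' z hz z' hz'
    have h1 : x'⁻¹ * x * y⁻¹ * y' * z⁻¹ * z' = 1 := by
      calc x'⁻¹ * x * y⁻¹ * y' * z⁻¹ * z' = x'⁻¹ * (x * y⁻¹ * y' * z⁻¹) * z' := by simp only [mul_assoc]
        _ = 1 := by rw [hprod]; group
    exact hiff.mp fun i => by rw [h1]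
  · -- separating polynomials of weighted degree ≤ s for every target (x₀, z₀)
    intro x₀ hx₀ z₀ hz₀
    rcases Y.eq_empty_or_nonempty with hY | ⟨y₁, hy₁⟩
    · refine ⟨0, ?_, ?_⟩
      · rw [MvPolynomial.weightedTotalDegree_zero]
        exact bot_le
      · intro x _ y hy
        simp [hY] at hy
    · -- target values: the coordinates of the identity
      obtain ⟨t, ht⟩ : ∃ t : Fin k → ℂ, ∀ i, t i = MvPolynomial.eval (fun ij : Fin d × Fin d =>
          (((1 : Matrix.SpecialLinearGroup (Fin d) ℤ) : Matrix (Fin d) (Fin d) ℤ) ij.1 ij.2 : ℂ)) (u i) :=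
        ⟨_, fun i => rfl⟩
      have hmem : ∀ i, t i ∈ V i := by
        obtain ⟨hV, hiff⟩ := hcert x₀ hx₀ x₀ hx₀ y₁ hy₁ y₁ hy₁ z₀ hz₀ z₀ hz₀
        have heq := hiff.mpr ⟨rfl, rfl, rfl⟩
        intro i
        rw [ht, ← heq i]
        exact hV i
      obtain ⟨L, hLdeg, hLval⟩ := hInd d k u V t hmem
      have hxU := hU x₀ (Finset.mem_union_left Z (Finset.mem_union_left Y hx₀))
      have hzU := hU z₀ (Finset.mem_union_right (X ∪ Y) hz₀)
      obtain ⟨L', hL'deg, hL'val⟩ := hRec d x₀ z₀ hxU hzU L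
      refine ⟨L', hL'deg.trans (hLdeg.trans hprice), ?_⟩
      intro x hx y hy y' hy' z hz
      rw [hL'val]
      have hassoc : x₀⁻¹ * (x * y⁻¹ * y' * z⁻¹) * z₀ = x₀⁻¹ * x * y⁻¹ * y' * z⁻¹ * z₀ := by
        simp only [mul_assoc]
      rw [hassoc]
      obtain ⟨hV, hiff⟩ := hcert x₀ hx₀ x hx y hy y' hy' z hz z₀ hz₀
      rw [hLval _ hV]
      by_cases hc : x = x₀ ∧ y = y' ∧ z = z₀
      · have hall : ∀ i, MvPolynomial.eval (fun ij : Fin d × Fin d =>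
            (((x₀⁻¹ * x * y⁻¹ * y' * z⁻¹ * z₀ : Matrix.SpecialLinearGroup (Fin d) ℤ) :
              Matrix (Fin d) (Fin d) ℤ) ij.1 ij.2 : ℂ)) (u i) = t i :=
          fun i => (hiff.mpr hc i).trans (ht i).symm
        rw [if_pos hall, if_pos hc]
      · have hnall : ¬ ∀ i, MvPolynomial.eval (fun ij : Fin d × Fin d =>
            (((x₀⁻¹ * x * y⁻¹ * y' * z⁻¹ * z₀ : Matrix.SpecialLinearGroup (Fin d) ℤ) :
              Matrix (Fin d) (Fin d) ℤ) ij.1 ij.2 : ℂ)) (u i) = t i :=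
          fun hall => hc (hiff.mp fun i => (hall i).trans (ht i))
        rw [if_neg hnall, if_neg hc]

/-- **THE SKELETON THEOREM.** The crux `NilpotentThresholdDesigns` BY NAME from the three DECLARED stubs through the
sorry-free composition `NilpotentThresholdDesigns_of`; `closed = false` only through `stub_*` (it becomes the crux
proof when the last stub is discharged). [BlasiakCohnGrochowPrattUmans2024, §2.4] -/
theorem NilpotentThresholdDesigns_skeleton : NilpotentThresholdDesigns :=
  NilpotentThresholdDesigns_of stub_recenter stub_indicator stub_designs

end Summit.MatrixMultiplication.MatrixMultiplication.Cruxes.NilpotentThresholdDesigns.Birth
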